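/- Copyright: the b2b-balaban cell (near-miss cell 7), T⁴-continuum fan-out; row NE7b CRUX team (2), seat
t4-ne7b-formalise-leaf-02 (gen 31) — the E-side (key readings) part of the row OWNER's INTERFACE REQUEST NE7b IR-49-1
«THE FIBRE DECORATION» (RULING R-OWNER-49-1 (e), `CLAIMS.log` l.33479; SPEC v0∕v0.1 `CLAIMS.log` l.33613, §4 «what the
E-side owes for (ρ1)»; `HOME/INBOX.md` l.12792), part 2 of 3.  Released under the licence of the surrounding project. -/
import Summits.QuantumFields.BalabanUV.T4Continuum.Support.HistoryBankingFibreDecorKeys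
import Summits.QuantumFields.BalabanUV.T4Continuum.Support.HistoryBankingFibreResumWeighted

/-!
# IR-49-1 «THE FIBRE DECORATION», KEY SIDE (2∕3): the weighted count of the decorations of a key member

Summits-side support leaf of the T⁴-continuum cell (rung (B)+1 on a FINITE torus only; NOT infinite volume, NOT the
mass gap, NOT the Clay statement; NOT a proof of the spine estimate NE7b — the cell's OWN estimate, NOT PRINTED, NOT
PROVED).  [folklore] finite combinatorics over part 1 (`HistoryBankingFibreDecorKeys.decG`) and the owner's S25 weighted
node mass (`HistoryBankingFibreResumWeighted.nmass`, `sum_flags_le_exp`;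
`HistoryBankingFibreResum.fibreMass_of_decoration`); no `structure`, no `[cite:]` tag, nothing printed asserted, no
`Prop` fact minted, zero `sorry`.  B16 = [Balaban1989LargeFieldII] p. 383 («we estimate the factors by
exp(−p₀(g_j))» — a flagged cube beyond the first carries its own small factor) is quoted as a LOCATOR of a hypothesis
SHAPE only.

WHY.  SPEC IR-49-1 §2 types the per-member decoration mass in TWO currencies: crude (`u := 1`, a count — part 1:
`#(decG C G) = ncount (#C ·) G`) and WEIGHTED («resummed by weight, not counted», R-OWNER-48-2 ∕ M5-5b: a renewal
flagging a nonempty cube set `S` weighs `ε^{#S − 1}`, so an event's mass is `Σ_S ε^{#S−1} ≤ n(1+ε)^{n−1}` —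
`sum_flags_le_exp` — instead of `2^n`); SPEC v0.1 NOTE adds that a member-dependent part `e^{bv}` of the last exponent
also rides on `u`.  On the decorated genealogies of part 1 a weight MULTIPLIED ALONG THE NODES is the owner's node mass
`nmass μ` read on `Gen (ε × β)` (`μ (e, x)` the weight of letter `x` at event `e`), and THE WEIGHTED COUNT FACTORISES:
`Σ_{G' ∈ decG C G} nmass μ G' = nmass (e ↦ Σ_{x ∈ C e} μ (e, x)) G` (`sum_nmass_decG_eq`) — M5-5b's hypothesis
`Σ_{x ∈ Dec w} u w x ≤ nmass M w.2.1` (`mass_le_exp_nsum_of_le_nmass`) with EQUALITY at `Dec w := decG (C w) w.2.1`,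
`u w := nmass (μ w)`, `M e := Σ_{x ∈ C w e} μ w (e, x)`.  Hence (ρ3) in the weighted currency is kernel from the
per-event letters `0 ≤ μ`, `Σ_{x ∈ C e} μ (e, x) ≤ exp (φ e)` ON THE MEMBER's OWN EVENTS (`nmass_le_exp_nsum_of_events`
— the owner's `nmass_le_exp_nsum` with hypotheses restricted to `G.events`; at a merger `sharpT = 0` ⇒ the letter reads
`Σ μ ≤ 1`).

WHAT.  §1 `nmass_nonneg_of_events`, `nmass_le_exp_nsum_of_events`, **`sum_nmass_decG_eq`**, `nmass_nonneg_of_mem_decG`,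
`sum_nmass_decG_le_exp_nsum`.  §2 on a key: `hmassW_decG` (SPEC's `hmass`, weighted).  §3 the assembled junction over
any term type **`fibreMass_of_genDecorationW`** = the owner's `fibreMass_of_decoration` at `Dec := decG`,
`u w := nmass (μ w)`, concluding LITERALLY `∑ τ ∈ fibre kmem T K k, dmass τ ≤ W * MULTOf φ k`.  §4 a decided toy (the
two-event genealogy of part 1 with letter weights `1∕4`: total weight `1 = (4·¼)·(4·¼)`).

HONEST SCOPE.  Bookkeeping over OUR carriers; WHICH weights `μ` an event's letters carry (e.g. `ε_h^{#S−1}` at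
`ε_h = e^{−p₀(g_h)}`, or `e^{bv}`) is the READING's ∕ the supplier's; (ρ1) (`dec`, `hmem`, `hinj`) and (ρ2) stay
displays;
(ρ3) kernel modulo FIBRE-1's letters.  BY-NAME EFFECT ON THE WALL: NONE by this file alone.  NE7b NOT PRINTED ∕ NOT
PROVED; spine 0∕9.  HONEST DEPENDENCY (cell): continuum YM on T⁴ ⇐ BetaPertH ∧ nine spine estimates (0/9 proved);
BetaPertH ⇐ (D1) ∧ (D4) ∧ CAP+tail; G-an2-4 gates asym, D1 and NE2/3/4.  This file changes none of it.
-/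

open Finset
open Literature.MathematicalPhysics.QuantumFieldTheory.Balaban1983to89
open T4PersistenceDictionary T4LiveClassFibration
open Summit.QuantumFields.BalabanUV.T4Continuum.HistoryPriceNodeSum
open Summit.QuantumFields.BalabanUV.T4Continuum.HistoryPriceKeys
open Summit.QuantumFields.BalabanUV.T4Continuum.HistoryBankingFibreResum
open Summit.QuantumFields.BalabanUV.T4Continuum.HistoryBankingFibreResumWeighted
open Summit.QuantumFields.BalabanUV.T4Continuum.HistoryBankingFibreDecorKeys

namespace Summit.QuantumFields.BalabanUV.T4Continuum.HistoryBankingFibreDecorWeighted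

noncomputable section

/-! ## §1 The weighted count: node-multiplicative weights on the decorations factorise over the nodes -/

section Weighted

variable {ε β : Type*} [DecidableEq ε] [DecidableEq β]

/-- the node mass of per-event masses nonnegative ON THE GENEALOGY's EVENTS is nonnegative (the owner's `nmass_nonneg`,
hypothesis restricted to `G.events`) [folklore] -/
theorem nmass_nonneg_of_events (M : ε → ℝ) : ∀ G : Gen ε, (∀ e ∈ G.events, 0 ≤ M e) → 0 ≤ nmass M G
  | Gen.born b _, h => by
    rw [nmass_born]
    exact h b (by simp)
  | Gen.renew G e _, h => by
    rw [nmass_renew]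
    exact mul_nonneg (nmass_nonneg_of_events M G fun e' he' => h e' (by simp [he'])) (h e (by simp))
  | Gen.merge X Y e, h => by
    rw [nmass_merge]
    exact mul_nonneg (mul_nonneg (nmass_nonneg_of_events M X fun e' he' => h e' (by simp [he']))
      (nmass_nonneg_of_events M Y fun e' he' => h e' (by simp [he']))) (h e (by simp))

/-- **THE NODE MASS AGAINST THE SHARES, ASKED ON THE GENEALOGY's OWN EVENTS ONLY** (the owner's `nmass_le_exp_nsum`,
hypotheses restricted to `G.events`). [folklore] -/
theorem nmass_le_exp_nsum_of_events (M : ε → ℝ) (φ : ε → ℝ) : ∀ G : Gen ε, (∀ e ∈ G.events, 0 ≤ M e) →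
    (∀ e ∈ G.events, M e ≤ Real.exp (φ e)) → nmass M G ≤ Real.exp (nsum φ G)
  | Gen.born b _, _, h => by
    rw [nmass_born, nsum_born]
    exact h b (by simp)
  | Gen.renew G e _, h0, h => by
    rw [nmass_renew, nsum_renew, Real.exp_add]
    exact mul_le_mul (nmass_le_exp_nsum_of_events M φ G (fun e' he' => h0 e' (by simp [he']))
      fun e' he' => h e' (by simp [he'])) (h e (by simp)) (h0 e (by simp)) (Real.exp_nonneg _)
  | Gen.merge X Y e, h0, h => by
    rw [nmass_merge, nsum_merge, Real.exp_add, Real.exp_add]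
    exact mul_le_mul (mul_le_mul (nmass_le_exp_nsum_of_events M φ X (fun e' he' => h0 e' (by simp [he']))
      fun e' he' => h e' (by simp [he'])) (nmass_le_exp_nsum_of_events M φ Y (fun e' he' => h0 e' (by simp [he']))
      fun e' he' => h e' (by simp [he'])) (nmass_nonneg_of_events M Y fun e' he' => h0 e' (by simp [he']))
      (Real.exp_nonneg _)) (h e (by simp)) (h0 e (by simp)) (by positivity)

/-- **THE WEIGHTED COUNT OF THE DECORATIONS FACTORISES OVER THE NODES**: with a per-node weight `μ (e, x)` MULTIPLIED
along the decorated genealogy — the owner's node mass `nmass μ` on `Gen (ε × β)`, e.g. `μ (e, S) = ε_h ^ (#S − 1)` for a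
renewal flagging the cube set `S` (M5-5b's weighted currency) — the total weight of `decG C G` is the node mass of the
per-event sums: `Σ_{G' ∈ decG C G} nmass μ G' = nmass (e ↦ Σ_{x ∈ C e} μ (e, x)) G`.  SPEC §2's weighted display
`Σ_{x ∈ Dec w} u w x ≤ nmass M w.2.1` holds with EQUALITY at `Dec w := decG C w.2.1`, `u w := nmass μ`. [folklore] -/
theorem sum_nmass_decG_eq (C : ε → Finset β) (μ : ε × β → ℝ) :
    ∀ G : Gen ε, ∑ G' ∈ decG C G, nmass μ G' = nmass (fun e => ∑ x ∈ C e, μ (e, x)) G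
  | Gen.born b j => by
    rw [decG_born, Finset.sum_image fun x _ y _ h => (Prod.mk.inj (Gen.born.inj h).1).2, nmass_born]
    rfl
  | Gen.renew G e hh => by
    rw [decG_renew, Finset.sum_image, nmass_renew, ← sum_nmass_decG_eq C μ G, Finset.sum_product, Finset.sum_mul]
    · refine Finset.sum_congr rfl fun G' _ => ?_
      rw [Finset.mul_sum]
      rfl
    · intro p _ q _ h
      obtain ⟨h1, h2, -⟩ := Gen.renew.inj h
      exact Prod.ext h1 (Prod.mk.inj h2).2
  | Gen.merge X Y e => by
    rw [decG_merge, Finset.sum_image, nmass_merge, ← sum_nmass_decG_eq C μ X, ← sum_nmass_decG_eq C μ Y,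
      Finset.sum_product, Finset.sum_product, Finset.sum_mul_sum, Finset.sum_mul]
    · refine Finset.sum_congr rfl fun X' _ => ?_
      rw [Finset.sum_mul]
      refine Finset.sum_congr rfl fun Y' _ => ?_
      rw [Finset.mul_sum]
      rfl
    · intro p _ q _ h
      obtain ⟨h1, h2, h3⟩ := Gen.merge.inj h
      exact Prod.ext (Prod.ext h1 h2) (Prod.mk.inj h3).2

/-- the node-multiplicative weight of a decoration is nonnegative when the per-node weights are, on the member's events
and their choice sets [folklore] -/
theorem nmass_nonneg_of_mem_decG (C : ε → Finset β) (μ : ε × β → ℝ) {G : Gen ε}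
    (hμ : ∀ e ∈ G.events, ∀ x ∈ C e, 0 ≤ μ (e, x)) : ∀ G' ∈ decG C G, 0 ≤ nmass μ G' := fun G' hG' =>
  nmass_nonneg_of_events μ G' fun n hn =>
    hμ n.1 (fst_mem_events_of_mem_decG C hG' n hn) n.2 (snd_mem_of_mem_decG C hG' n hn)

/-- **(ρ3), WEIGHTED CURRENCY, PER MEMBER**: per-event letters `0 ≤ Σ_{x ∈ C e} μ (e, x) ≤ exp (φ e)` on the genealogy's
events give `Σ_{G' ∈ decG C G} nmass μ G' ≤ exp (nsum φ G)`. [folklore] -/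
theorem sum_nmass_decG_le_exp_nsum (C : ε → Finset β) (μ : ε × β → ℝ) (φ : ε → ℝ) (G : Gen ε)
    (h0 : ∀ e ∈ G.events, ∀ x ∈ C e, 0 ≤ μ (e, x)) (h : ∀ e ∈ G.events, ∑ x ∈ C e, μ (e, x) ≤ Real.exp (φ e)) :
    ∑ G' ∈ decG C G, nmass μ G' ≤ Real.exp (nsum φ G) := by
  rw [sum_nmass_decG_eq]
  exact nmass_le_exp_nsum_of_events _ φ G (fun e he => Finset.sum_nonneg (h0 e he)) h

end Weighted

/-! ## §2 On a key: SPEC IR-49-1 §2's `hmass` in the weighted currency -/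

section Key

variable {γ δ' β : Type*} [DecidableEq β]

/-- **SPEC's `hmass` IN THE WEIGHTED CURRENCY**: for every member `w` of the key, per-event letters on ITS events give
`Σ_{G' ∈ decG (C w) w.2.1} nmass (μ w) G' ≤ exp (nsum φ w.2.1)`. [folklore] -/
theorem hmassW_decG (φ : PEv → ℝ) (k : Finset (γ × Gen PEv × δ')) (C : γ × Gen PEv × δ' → PEv → Finset β)
    (μ : γ × Gen PEv × δ' → PEv × β → ℝ)
    (h0 : ∀ w ∈ k, ∀ e ∈ w.2.1.events, ∀ x ∈ C w e, 0 ≤ μ w (e, x))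
    (hC : ∀ w ∈ k, ∀ e ∈ w.2.1.events, ∑ x ∈ C w e, μ w (e, x) ≤ Real.exp (φ e)) :
    ∀ w ∈ k, ∑ G' ∈ decG (C w) w.2.1, nmass (μ w) G' ≤ Real.exp (nsum φ w.2.1) :=
  fun w hw => sum_nmass_decG_le_exp_nsum (C w) (μ w) φ w.2.1 (h0 w hw) (hC w hw)

end Key

/-! ## §3 THE ASSEMBLED JUNCTION over any term type: (ρ) from a genealogy decoration, weighted currency -/

section Junction

variable {ι γ δ' β κ : Type*} [DecidableEq γ] [DecidableEq δ'] [DecidableEq β]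

/-- **(ρ) `FibreMass` FROM A GENEALOGY DECORATION OF THE KEY FIBRE, WEIGHTED CURRENCY** — the owner's
`fibreMass_of_decoration` at `Dec w := decG (C w) w.2.1`, `u w := nmass (μ w)` (a per-node weight multiplied along the
member's decorated genealogy; SPEC v0.1 NOTE: a member-dependent part `e^{bv}` of the last exponent goes here); (ρ3)'s
letters are `0 ≤ μ` and `Σ_{x ∈ C w e} μ w (e, x) ≤ exp (φ e)` on every member's events. [folklore] -/
theorem fibreMass_of_genDecorationW (kmem : ℕ → ι → Finset (γ × Gen PEv × δ')) (T : ℕ → Finset ι) (K : ℕ)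
    (k : Finset (γ × Gen PEv × δ')) (dmass : ι → ℝ) (φ : PEv → ℝ) {W : ℝ}
    (C : γ × Gen PEv × δ' → PEv → Finset β) (μ : γ × Gen PEv × δ' → PEv × β → ℝ)
    (dec : ι → γ × Gen PEv × δ' → Gen (PEv × β))
    (Csl : Finset κ) (slice : ι → κ) {v : κ → ℝ} (hv : ∀ c ∈ Csl, 0 ≤ v c) (hW : ∑ c ∈ Csl, v c ≤ W)
    (hsl : ∀ τ ∈ fibre kmem T K k, slice τ ∈ Csl)
    (hmem : ∀ τ ∈ fibre kmem T K k, ∀ w ∈ k, dec τ w ∈ decG (C w) w.2.1)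
    (hinj : ∀ τ ∈ fibre kmem T K k, ∀ τ' ∈ fibre kmem T K k,
      slice τ = slice τ' → (∀ w ∈ k, dec τ w = dec τ' w) → τ = τ')
    (hfac : ∀ τ ∈ fibre kmem T K k, dmass τ ≤ v (slice τ) * ∏ w ∈ k, nmass (μ w) (dec τ w))
    (h0 : ∀ w ∈ k, ∀ e ∈ w.2.1.events, ∀ x ∈ C w e, 0 ≤ μ w (e, x))
    (hC : ∀ w ∈ k, ∀ e ∈ w.2.1.events, ∑ x ∈ C w e, μ w (e, x) ≤ Real.exp (φ e)) :
    ∑ τ ∈ fibre kmem T K k, dmass τ ≤ W * MULTOf φ k :=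
  fibreMass_of_decoration kmem T K k dmass φ (fun w => decG (C w) w.2.1) dec Csl slice hv hW
    (u := fun w G' => nmass (μ w) G') (fun w hw G' hG' => nmass_nonneg_of_mem_decG (C w) (μ w) (h0 w hw) G' hG')
    hsl hmem hinj hfac (hmassW_decG φ k C μ h0 hC)

end Junction

/-! ## §4 A decided toy: the two-event genealogy of part 1 with letter weights `1∕4` -/

section Toy

/-- the toy letter weight: every letter at every event weighs `1∕4` [folklore] -/
def toyμ : PEv × List (Finset (Fin 1) × Finset (Fin 1)) → ℝ := fun _ => 1 / 4

/-- each event's four letters weigh `1` in total [folklore] -/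
theorem toy_event_mass (e : PEv) : ∑ x ∈ toyC e, toyμ (e, x) = 1 := by
  simp only [toyμ, Finset.sum_const, card_toyC, nsmul_eq_mul]
  norm_num

/-- **THE TOY WEIGHTED COUNT**: the sixteen decorations weigh `1 = 1 · 1` in total (`sum_nmass_decG_eq`), within
`exp (nsum 0 toyG) = 1` — tight. [folklore] -/
theorem sum_nmass_toy : ∑ G' ∈ decG toyC toyG, nmass toyμ G' = 1 := by
  rw [sum_nmass_decG_eq, toyG, nmass_renew, nmass_born, toy_event_mass, toy_event_mass, mul_one]

end Toy

end

end Summit.QuantumFields.BalabanUV.T4Continuum.HistoryBankingFibreDecorWeighted
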